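import Summits.CriticalPhenomena.CardyFormulaZ2.Theorems.CardyBoundaryCoulombGasBoundaryDefectGaussianRStubRealisabilityPart22
import Literature.Probability.LatticeModels.CollarLegModelConfigs

/-!
# Stub `stub_realisability` of line `rainbow-monomials-in-excursion-kernels` — Part 23:
# strand ends of the collar walk (IV): the two cells at an end and their heights (`s14_strandEnds_pairs`)
# (crux `BoundaryDefectGaussianR`, stmt-CriticalPhenomena-14132; insertion dictionary D2, layer 3b)

For an admissible leg insertion `ι` on `V` with flat insertion points, every strand end
`(c, m) ∈ ι.strandEnds V` is a TRACKED corner of the jump collar `ι.model V` and in every valid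
height configuration the two cells of `c` carry the heights `m` and `m + 1`
(`se_pairs_main`, registered one-line form `s14_strandEnds_pairs`). By the analysis of Parts
21/22 an end is created at a rail dart `ds[t] = (c, K)` of a flat stretch, and (Part 7 semantics):

* `se_collar_face_after` / `se_collar_face_before` — if the stretch after (before) the dart is
  free, the gap face after `(c, K)` (after the previous rail dart `(c - dir (K+1), K)`) is a
  face-cell, not free (neither interior nor a pocket: gap-face uniqueness), at the level after
  (before) the dart (`collar_faceH_gapFace`; for `t = 0` the walk closes up, `se_pred_index`);
* `se_ghost_cell`, `se_ghost_vertH_close/open` — on a wired stretch the ghost `c + dir K` is a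
  ghost vertex-cell prescribed at the wired level (`collar_vertH_eq`; the only earlier mention is
  as a pocket corner of the previous dart, `se_ghost_mention_earlier`, by the ghost uniqueness facts
  of Part 20);
* `se_jump_vertex_free` — the vertex of a jump edge is a free vertex (its only dart is free on both
  sides), so validity squeezes its height between the collar faces at `ℓ` and `ℓ ± 2` to the
  middle value (`se_middle_of_abs`).

Jump ends `(c, K+3)`, `(c, K)`: pairs `{(ℓ+ℓ')/2, ℓ}`, `{(ℓ+ℓ')/2, ℓ'}`; closing junction
`(g, K+1)`: ghost at `ℓ` against the face after at `ℓ'`; opening junction `(g, K+2)`: ghost at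
`ℓ'` against the face before at `ℓ`. All [folklore] bookkeeping over the definitions.
-/

namespace Summit.CriticalPhenomena.CardyFormulaZ2.Cruxes.BoundaryDefectGaussianR.RainbowMonomialsInExcursionKernels

open Literature.Probability.LatticeModels Literature.Probability.LatticeModels.CollarLegModel

/-! ## Part D: the cells at a strand end and their heights -/

section Cells

variable (ι : LegInsertionData) (V : Finset (ℤ × ℤ)) {d₀ : Dart} (hadm : ι.IsAdmissible V)
  (h : outDart V ι.sink = some d₀) {st : ℕ → WalkState}
  (hst : ∀ t, st t = List.foldl (fun s d => s.step (ι.startAt V d)) ι.init ((cycle V d₀).take t))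
  {t : ℕ} (ht : t < (cycle V d₀).length) {c : ℤ × ℤ} {K : Fin 4}
  (hch : ∀ s t : ℤ, -2 ≤ s → s ≤ 2 → -2 ≤ t → t ≤ 2 → (c + s • dir (K + 1) + t • dir K ∈ V ↔ t ≤ 0))
  (hchp : ∀ s t : ℤ, -2 ≤ s → s ≤ 2 → -2 ≤ t → t ≤ 2 →
    (c - dir (K + 1) + s • dir (K + 1) + t • dir K ∈ V ↔ t ≤ 0))
  (hds : (cycle V d₀)[t] = (c, K))
  (hpred1 : ∀ (h1 : 1 ≤ t), (cycle V d₀)[t - 1] = (c - dir (K + 1), K))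
  (hpred0 : t = 0 → (cycle V d₀)[(cycle V d₀).length - 1]'(by omega) = (c - dir (K + 1), K))

include hadm h hst ht hch hds in
/-- **The collar face after a rail dart.** If the stretch after the rail dart `ds[t] = (c, K)` is
free, its gap face is a face-cell that is not free, at the level after the dart. [folklore] -/
theorem se_collar_face_after (hw : (st (t + 1)).wired = false) :
    gapFace (c, K) ∈ (ι.model V).faceCells ∧ (gapFace (c, K), true) ∉ (ι.model V).freeCells ∧
      (ι.collar V).faceH (gapFace (c, K)) = (st (t + 1)).level := by
  obtain ⟨hcV, hcK, -⟩ := se_rail_local hch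
  have huniq : ∀ (t' : ℕ) (ht' : t' < (cycle V d₀).length), gapFace (cycle V d₀)[t'] = gapFace (c, K) → t' = t := by
    intro t' ht' hg
    have hext := se_cycle_exterior ι V hadm h ht'
    have := se_rail_gapFace_unique hch hext.1 hext.2 hg
    exact se_cycle_index_inj ι V hadm h ht' ht (this.trans hds.symm)
  refine ⟨mem_faceCells_of_mem_vertexFaces _ hcV (se_gapFace_mem_vertexFaces c K).1, ?_, ?_⟩
  · rw [mem_freeCells_true, freeFaces, Finset.mem_union, not_or]
    constructor
    · rw [interiorFaces, Finset.mem_filter, not_and]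
      intro _ hsub
      exact hcK (hsub (se_ghost_mem_faceCorners c K).1)
    · rw [pockets, Finset.mem_inter, not_and']
      intro _ hp
      obtain ⟨t', ht', hw', hg⟩ := (mem_collar_pocket_iff ι V h hst).1 hp
      obtain rfl := huniq t' ht' hg
      rw [hw] at hw'
      exact Bool.false_ne_true hw'
  · have := collar_faceH_gapFace ι V h hst ht hw fun t' ht' _ hg => ?_
    · rwa [hds] at this
    · exfalso
      rw [hds] at hg
      have := huniq t' (by omega) hg
      omega

include hadm h hst ht hpred1 hpred0 in
/-- The cyclically previous dart of the rail dart `ds[t]`: its index, and the level and wiredness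
after it (those before `ds[t]`; for `t = 0` the walk closes up). [folklore] -/
theorem se_pred_index : ∃ (tp : ℕ) (_ : tp < (cycle V d₀).length),
    (cycle V d₀)[tp] = (c - dir (K + 1), K) ∧ (st (tp + 1)).level = (st t).level ∧
      (st (tp + 1)).wired = (st t).wired ∧ (1 ≤ t → tp = t - 1) := by
  have hP := length_cycle_pos ι V hadm h
  rcases Nat.eq_zero_or_pos t with ht0 | htpos
  · refine ⟨(cycle V d₀).length - 1, by omega, hpred0 ht0, ?_, ?_, fun h1 => by omega⟩
    · rw [Nat.sub_add_cancel hP, ht0, (st_final ι V hadm h hst).1, hst 0]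
      rfl
    · rw [Nat.sub_add_cancel hP, ht0, (st_final ι V hadm h hst).2.1, hst 0]
      rfl
  · exact ⟨t - 1, by omega, hpred1 htpos, by rw [Nat.sub_add_cancel htpos], by rw [Nat.sub_add_cancel htpos],
      fun _ => rfl⟩

include hadm h hst ht hch hchp hpred1 hpred0 in
/-- **The collar face before a rail dart.** If the stretch before the rail dart `ds[t] = (c, K)` is
free, the gap face of the previous rail dart `(c - dir (K+1), K)` is a face-cell that is not free,
at the level before the dart. [folklore] -/
theorem se_collar_face_before (hw : (st t).wired = false) :
    gapFace (c - dir (K + 1), K) ∈ (ι.model V).faceCells ∧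
      (gapFace (c - dir (K + 1), K), true) ∉ (ι.model V).freeCells ∧
      (ι.collar V).faceH (gapFace (c - dir (K + 1), K)) = (st t).level := by
  obtain ⟨hcV, hcK, -⟩ := se_rail_local hch
  obtain ⟨tp, htp, hdsp, hlp, hwp, -⟩ := se_pred_index ι V hadm h hst ht hpred1 hpred0
  have huniq : ∀ (t' : ℕ) (ht' : t' < (cycle V d₀).length),
      gapFace (cycle V d₀)[t'] = gapFace (c - dir (K + 1), K) → t' = tp := by
    intro t' ht' hg
    have hext := se_cycle_exterior ι V hadm h ht'
    have := se_rail_gapFace_unique hchp hext.1 hext.2 hg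
    exact se_cycle_index_inj ι V hadm h ht' htp (this.trans hdsp.symm)
  refine ⟨mem_faceCells_of_mem_vertexFaces _ hcV (se_gapFace_mem_vertexFaces c K).2.1, ?_, ?_⟩
  · rw [mem_freeCells_true, freeFaces, Finset.mem_union, not_or]
    constructor
    · rw [interiorFaces, Finset.mem_filter, not_and]
      intro _ hsub
      exact hcK (hsub (se_ghost_mem_faceCorners c K).2)
    · rw [pockets, Finset.mem_inter, not_and']
      intro _ hp
      obtain ⟨t', ht', hw', hg⟩ := (mem_collar_pocket_iff ι V h hst).1 hp
      obtain rfl := huniq t' ht' hg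
      rw [hwp, hw] at hw'
      exact Bool.false_ne_true hw'
  · have hwp' : (st (tp + 1)).wired = false := hwp.trans hw
    have := collar_faceH_gapFace ι V h hst htp hwp' fun t' ht' _ hg => ?_
    · rwa [hdsp, hlp] at this
    · exfalso
      rw [hdsp] at hg
      have := huniq t' (by omega) hg
      omega

include h hst ht hch hds in
/-- **The ghost of a rail dart on a wired stretch** is a ghost vertex-cell (not free). [folklore] -/
theorem se_ghost_cell (hw : (st t).wired = true ∨ (st (t + 1)).wired = true) :
    c + dir K ∈ (ι.model V).vertexCells ∧ (c + dir K, false) ∉ (ι.model V).freeCells := by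
  obtain ⟨hcV, hcK, -⟩ := se_rail_local hch
  have harc : c ∈ (ι.collar V).arc := (mem_collar_arc_iff ι V h hst).2 ⟨t, ht, hw, by rw [hds]⟩
  constructor
  · rw [vertexCells, Finset.mem_union]
    right
    rw [ghosts, Finset.mem_sdiff, Finset.mem_union]
    refine ⟨Or.inl (Finset.mem_biUnion.2 ⟨c, ?_, se_ghost_mem_neighbours c K⟩), hcK⟩
    exact Finset.mem_inter.2 ⟨harc, hcV⟩
  · rw [mem_freeCells_false, freeVerts, Finset.mem_sdiff, not_and']
    intro _ hgV
    exact hcK hgV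

include hadm h ht hch hds hpred1 in
/-- Earlier walk entries mentioning the ghost `c + dir K` of the rail dart `ds[t]`: only the
previous dart can, and only as a pocket corner (when the stretch before `ds[t]` is wired).
[folklore] -/
theorem se_ghost_mention_earlier {t' : ℕ} (ht' : t' < t) {ℓ : ℤ}
    (hm : LegInsertionData.mention V (c + dir K) ((cycle V d₀)[t'], st t', st (t' + 1)) = some ℓ) :
    (st t).wired = true ∧ ℓ = (st t).level := by
  obtain ⟨hcV, hcK, -⟩ := se_rail_local hch
  have hext := se_cycle_exterior ι V hadm h (t := t') (by omega)
  have hne : LegInsertionData.mention V (c + dir K) ((cycle V d₀)[t'], st t', st (t' + 1)) ≠ none := by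
    rw [hm]; simp
  rw [Ne, mention_eq_none_iff] at hne
  by_cases hA : ((st t').wired = true ∨ (st (t' + 1)).wired = true) ∧
      (((cycle V d₀)[t']).1 = c + dir K ∨ dartTip (cycle V d₀)[t'] = c + dir K)
  · exfalso
    rcases hA.2 with h1 | h1
    · exact hcK (h1 ▸ hext.1)
    · have := se_rail_tip_unique hch hext.1 h1
      have := se_cycle_index_inj ι V hadm h (by omega) ht (this.trans hds.symm)
      omega
  by_cases hB : (st (t' + 1)).wired = true ∧ c + dir K ∈ SixVertex.faceCorners (gapFace (cycle V d₀)[t']) ∧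
      c + dir K ∉ V
  · obtain ⟨hwB, hcB, -⟩ := hB
    rcases se_rail_ghostCorner hch hext.1 hext.2 hcB with hd | hd
    · exfalso
      have := se_cycle_index_inj ι V hadm h (by omega) ht (hd.trans hds.symm)
      omega
    · have h1 : 1 ≤ t := by omega
      have htt : t' = t - 1 := se_cycle_index_inj ι V hadm h (by omega) (by omega) (hd.trans (hpred1 h1).symm)
      subst htt
      rw [Nat.sub_add_cancel h1] at hwB hm
      refine ⟨hwB, ?_⟩
      have hx : ((cycle V d₀)[t - 1]).1 ≠ c + dir K ∧ dartTip (cycle V d₀)[t - 1] ≠ c + dir K := by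
        rw [hd]
        obtain ⟨e0, -, -, -⟩ := se_dir_frame K c
        constructor
        · show c - dir (K + 1) ≠ c + dir K
          have e : c - dir (K + 1) = c + (-1 : ℤ) • dir (K + 1) + (0 : ℤ) • dir K := by module
          rw [e, e0, Ne, se_frame_inj]; omega
        · show c - dir (K + 1) + dir K ≠ c + dir K
          have e : c - dir (K + 1) + dir K = c + (-1 : ℤ) • dir (K + 1) + (1 : ℤ) • dir K := by module
          rw [e, e0, Ne, se_frame_inj]; omega
      have := mention_of_pocketCorner V (e := ((cycle V d₀)[t - 1], st (t - 1), st t)) hx hwB hcB hcK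
      rw [this] at hm
      exact (Option.some.inj hm).symm
  · exact absurd ⟨hA, hB⟩ hne

include hadm h hst ht hch hds hpred1 in
/-- **The ghost at a junction closing the arc** (wired before `ds[t]`) is prescribed at the level
before the dart. [folklore] -/
theorem se_ghost_vertH_close (hw : (st t).wired = true) : (ι.collar V).vertH (c + dir K) = (st t).level := by
  refine collar_vertH_eq ι V h hst ht ?_ fun t' ht' ℓ' hm' => ?_
  · rw [hds, mention_of_vertex V (x := c + dir K) (e := ((c, K), st t, st (t + 1))) (Or.inl hw) (Or.inr rfl)]
    simp [hw]
  · exact (se_ghost_mention_earlier ι V hadm h ht hch hds hpred1 ht' hm').2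

include hadm h hst ht hch hds hpred1 in
/-- **The ghost at a junction opening the arc** (free before, wired after `ds[t]`) is prescribed at
the level after the dart. [folklore] -/
theorem se_ghost_vertH_open (hw : (st t).wired = false) (hw' : (st (t + 1)).wired = true) :
    (ι.collar V).vertH (c + dir K) = (st (t + 1)).level := by
  refine collar_vertH_eq ι V h hst ht ?_ fun t' ht' ℓ' hm' => ?_
  · rw [hds, mention_of_vertex V (x := c + dir K) (e := ((c, K), st t, st (t + 1))) (Or.inr hw') (Or.inr rfl)]
    simp [hw]
  · exfalso
    have := (se_ghost_mention_earlier ι V hadm h ht hch hds hpred1 ht' hm').1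
    rw [hw] at this
    exact Bool.false_ne_true this

include hadm h hst ht hch hds in
/-- **The vertex of a jump edge is free.** If the rail dart `ds[t]` is free on both sides, its
vertex is a free vertex-cell. [folklore] -/
theorem se_jump_vertex_free (hw : (st t).wired = false) (hw' : (st (t + 1)).wired = false) :
    (c, false) ∈ (ι.model V).freeCells := by
  obtain ⟨hcV, -, -⟩ := se_rail_local hch
  rw [mem_freeCells_false, freeVerts, Finset.mem_sdiff]
  refine ⟨hcV, fun harc => ?_⟩
  obtain ⟨t', ht', hw'', hx⟩ := (mem_collar_arc_iff ι V h hst).1 harc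
  have hext := se_cycle_exterior ι V hadm h ht'
  have := se_rail_dart_unique hch hx hext.2
  obtain rfl := se_cycle_index_inj ι V hadm h ht' ht (this.trans hds.symm)
  rw [hw, hw'] at hw''
  simp at hw''

end Cells

section Pairs

variable (ι : LegInsertionData) (V : Finset (ℤ × ℤ)) {d₀ : Dart} (hadm : ι.IsAdmissible V)
  (h : outDart V ι.sink = some d₀) {st : ℕ → WalkState}
  (hst : ∀ t, st t = List.foldl (fun s d => s.step (ι.startAt V d)) ι.init ((cycle V d₀).take t))

/-- Two unit steps from `a` to levels two apart pin `a` to the middle. [folklore] -/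
theorem se_middle_of_abs {a ℓ ℓ' : ℤ} (h1 : |a - ℓ| = 1) (h2 : |a - ℓ'| = 1) (hj : ℓ' = ℓ + 2 ∨ ℓ = ℓ' + 2) :
    a = (ℓ + ℓ') / 2 := by
  rw [abs_eq (zero_le_one' ℤ)] at h1 h2
  omega

include hadm h hst in
/-- **The cells at a strand end and their heights** (positional form of `s14_strandEnds_pairs`).
[folklore] -/
theorem se_pairs_main
    (hflat : ∀ x ∈ insert ι.sink ι.source, ∃ d : ℤ × ℤ, (d = (1, 0) ∨ d = (-1, 0) ∨ d = (0, 1) ∨ d = (0, -1)) ∧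
      ∀ v : ℤ × ℤ, (v.1 - x.1) ^ 2 + (v.2 - x.2) ^ 2 ≤ ((ι.sinkLegs : ℤ) + 3) ^ 2 →
        (v ∈ V ↔ 0 ≤ (v.1 - x.1) * d.1 + (v.2 - x.2) * d.2))
    {e : (Site 2 × Fin 4) × ℤ} (he : e ∈ ι.strandEnds V) :
    (ι.model V).IsTracked e.1 ∧ ∀ hh : ↥(ι.model V).freeCells → ℤ, (ι.model V).IsValid hh →
      min ((ι.model V).hv hh (ofSite e.1.1)) ((ι.model V).hf hh (ofSite (cFace e.1))) = e.2 ∧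
      max ((ι.model V).hv hh (ofSite e.1.1)) ((ι.model V).hf hh (ofSite (cFace e.1))) = e.2 + 1 := by
  obtain ⟨t, ht, hte⟩ := (se_mem_strandEnds_iff ι V h hst).1 he
  have hact : (st (t + 1)).level ≠ (st t).level := fun h0 => by
    rw [se_endsAt_nil _ _ _ h0] at hte; simp at hte
  obtain ⟨c, K, hch, hchp, hds, hpred1, hpred0⟩ := se_active_rail ι V hadm h hst hflat ht hact
  obtain ⟨hΔ, hjw, hnjw⟩ := se_active_delta ι V hst ht hact
  obtain ⟨hcV, hcK, -⟩ := se_rail_local hch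
  have hcVC : c ∈ (ι.model V).vertexCells := Finset.mem_union_left _ hcV
  obtain ⟨gf1, gf2, gf3, gf4⟩ := se_gapFace_eq_cFace c K
  rw [hds] at hte
  rcases se_endsAt_site _ _ _ hte with ⟨hj, hE⟩ | ⟨hnj, -, hE⟩
  · -- jump edge: free vertex `c` between the collar faces before and after
    obtain ⟨hw0, hw1⟩ := hjw hj
    obtain ⟨hfa1, hfa2, hfa3⟩ := se_collar_face_after ι V hadm h hst ht hch hds hw1
    obtain ⟨hfb1, hfb2, hfb3⟩ := se_collar_face_before ι V hadm h hst ht hch hchp hpred1 hpred0 hw0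
    have hcf := se_jump_vertex_free ι V hadm h hst ht hch hds hw0 hw1
    have key : ∀ hh : ↥(ι.model V).freeCells → ℤ, (ι.model V).IsValid hh →
        (ι.model V).hv hh c = ((st t).level + (st (t + 1)).level) / 2 ∧
        (ι.model V).hf hh (gapFace (c, K)) = (st (t + 1)).level ∧
        (ι.model V).hf hh (gapFace (c - dir (K + 1), K)) = (st t).level := by
      intro hh hval
      have ha : (ι.model V).hf hh (gapFace (c, K)) = (st (t + 1)).level := by
        rw [hf_of_not_mem _ _ hfa2]; exact hfa3
      have hb : (ι.model V).hf hh (gapFace (c - dir (K + 1), K)) = (st t).level := by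
        rw [hf_of_not_mem _ _ hfb2]; exact hfb3
      have v1 := hval c hcVC _ (se_gapFace_mem_vertexFaces c K).1 hfa1 (Or.inl hcf)
      have v2 := hval c hcVC _ (se_gapFace_mem_vertexFaces c K).2.1 hfb1 (Or.inl hcf)
      rw [ha] at v1
      rw [hb] at v2
      exact ⟨se_middle_of_abs v2 v1 hj, ha, hb⟩
    rcases hE with rfl | rfl
    · refine ⟨⟨by simpa using hcVC, by rw [← gf3]; exact hfb1⟩, fun hh hval => ?_⟩
      obtain ⟨k1, -, k3⟩ := key hh hval
      simp only [ofSite_toSite]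
      rw [← gf3, k1, k3]
      constructor <;> omega
    · refine ⟨⟨by simpa using hcVC, by rw [← gf1]; exact hfa1⟩, fun hh hval => ?_⟩
      obtain ⟨k1, k2, -⟩ := key hh hval
      simp only [ofSite_toSite]
      rw [← gf1, k1, k2]
      constructor <;> omega
  · -- junction: the ghost `c + dir K` against the collar face after (closing) / before (opening)
    have hw' := hnjw hnj
    have h1 : (st (t + 1)).level = (st t).level + 1 ∨ (st (t + 1)).level = (st t).level - 1 := by
      rcases hΔ with hd | hd | hd | hd
      · exact Or.inl hd
      · exact Or.inr hd
      · exact absurd (Or.inl hd) hnj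
      · exact absurd (Or.inr (by omega)) hnj
    rcases hE with ⟨hw, rfl⟩ | ⟨hw, rfl⟩
    · -- the arc closes: ghost at the level before, face after at the level after
      rw [hw] at hw'
      obtain ⟨hg1, hg2⟩ := se_ghost_cell ι V h hst ht hch hds (Or.inl hw)
      have hvert := se_ghost_vertH_close ι V hadm h hst ht hch hds hpred1 hw
      obtain ⟨hfa1, hfa2, hfa3⟩ := se_collar_face_after ι V hadm h hst ht hch hds (by simpa using hw')
      refine ⟨⟨by simpa [dartTip] using hg1, ?_⟩, fun hh _ => ?_⟩
      · show ofSite (cFace (toSite (c + dir K), K + 1)) ∈ (ι.model V).faceCells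
        rw [← gf2]; exact hfa1
      · show min ((ι.model V).hv hh (ofSite (toSite (c + dir K))))
            ((ι.model V).hf hh (ofSite (cFace (toSite (c + dir K), K + 1)))) = _ ∧
          max ((ι.model V).hv hh (ofSite (toSite (c + dir K))))
            ((ι.model V).hf hh (ofSite (cFace (toSite (c + dir K), K + 1)))) = _
        rw [ofSite_toSite, ← gf2, hv_of_not_mem _ _ hg2, hf_of_not_mem _ _ hfa2]
        rw [show (ι.model V).C = ι.collar V from rfl, hvert, hfa3]
        constructor <;> omega
    · -- the arc opens: ghost at the level after, face before at the level before
      rw [hw] at hw'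
      obtain ⟨hg1, hg2⟩ := se_ghost_cell ι V h hst ht hch hds (Or.inr (by simpa using hw'))
      have hvert := se_ghost_vertH_open ι V hadm h hst ht hch hds hpred1 hw (by simpa using hw')
      obtain ⟨hfb1, hfb2, hfb3⟩ := se_collar_face_before ι V hadm h hst ht hch hchp hpred1 hpred0 hw
      refine ⟨⟨by simpa [dartTip] using hg1, ?_⟩, fun hh _ => ?_⟩
      · show ofSite (cFace (toSite (c + dir K), K + 2)) ∈ (ι.model V).faceCells
        rw [← gf4]; exact hfb1
      · show min ((ι.model V).hv hh (ofSite (toSite (c + dir K))))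
            ((ι.model V).hf hh (ofSite (cFace (toSite (c + dir K), K + 2)))) = _ ∧
          max ((ι.model V).hv hh (ofSite (toSite (c + dir K))))
            ((ι.model V).hf hh (ofSite (cFace (toSite (c + dir K), K + 2)))) = _
        rw [ofSite_toSite, ← gf4, hv_of_not_mem _ _ hg2, hf_of_not_mem _ _ hfb2]
        rw [show (ι.model V).C = ι.collar V from rfl, hvert, hfb3]
        constructor <;> omega

end Pairs

/-- **Sub-goal `s14_strandEnds_pairs`** (registered on stmt-CriticalPhenomena-14132): for an
admissible leg insertion whose insertion points are flat to radius `L + 3`, every strand end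
`(c, m) ∈ strandEnds` is a TRACKED corner (its vertex a vertex-cell, its face a face-cell of the
jump collar) and in every valid height configuration the heights of its two cells are `m` and
`m + 1`: a jump end sits at the free vertex of the jump edge, squeezed between the collar faces at
levels `ℓ` and `ℓ ± 2`; a junction end sits at the ghost (prescribed at the wired level) against
the adjacent collar face (at the free level). [folklore] -/
theorem s14_strandEnds_pairs : ∀ (ι : Literature.Probability.LatticeModels.CollarLegModel.LegInsertionData) (V : Finset (ℤ × ℤ)), ι.IsAdmissible V → (∀ x ∈ insert ι.sink ι.source, ∃ d : ℤ × ℤ, (d = (1, 0) ∨ d = (-1, 0) ∨ d = (0, 1) ∨ d = (0, -1)) ∧ ∀ v : ℤ × ℤ, (v.1 - x.1) ^ 2 + (v.2 - x.2) ^ 2 ≤ ((ι.sinkLegs : ℤ) + 3) ^ 2 → (v ∈ V ↔ 0 ≤ (v.1 - x.1) * d.1 + (v.2 - x.2) * d.2)) → ∀ e ∈ ι.strandEnds V, (ι.model V).IsTracked e.1 ∧ ∀ h : ↥(ι.model V).freeCells → ℤ, (ι.model V).IsValid h → min ((ι.model V).hv h (Literature.Probability.LatticeModels.CollarLegModel.ofSite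 e.1.1)) ((ι.model V).hf h (Literature.Probability.LatticeModels.CollarLegModel.ofSite (Literature.Probability.LatticeModels.cFace e.1))) = e.2 ∧ max ((ι.model V).hv h (Literature.Probability.LatticeModels.CollarLegModel.ofSite e.1.1)) ((ι.model V).hf h (Literature.Probability.LatticeModels.CollarLegModel.ofSite (Literature.Probability.LatticeModels.cFace e.1))) = e.2 + 1 := by
  intro ι V hadm hflat e he
  obtain ⟨d₀, h, -⟩ := s3_of_admissible ι V hadm
  exact se_pairs_main ι V hadm h (st := fun t => List.foldl (fun s d => s.step (ι.startAt V d)) ι.init ((cycle V d₀).take t))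
    (fun _ => rfl) hflat he

end Summit.CriticalPhenomena.CardyFormulaZ2.Cruxes.BoundaryDefectGaussianR.RainbowMonomialsInExcursionKernels
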